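import Summits.QuantumFields.BalabanUV.InfraRed.StrongCouplingFluxBound
import Summits.QuantumFields.BalabanUV.InfraRed.StrongCouplingReflection
import HarnessLib

/-!
# Strong-coupling front, J-SC16j: the flux test field `W(y) = e^{κ y₀}(e + (α y₀ + β) y)` on `ℍ` —
its divergence, trace, size and reflection symmetry —
observatory of the non-perturbative crossover; no mass-gap claim

IR-3 v2 TWO-FRONT CROSSOVER LEDGER, front SC (`β₀`), SU(2), `d = 4`, Wilson normalisation `β_W = 4/g²`.
ABSOLUTE RULE of this package: No internally-minted statement may enter as a cited fact. Every hypothesis is either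
kernel-proved in this package or a verbatim quotation of a PUBLISHED theorem with page reference. The manuscript(s)
under audit are NOT citable for their own disputed steps — they are the thing under adjudication; programme-internal
(2001/route/tribunal) claims are never citable.  Nothing is cited here: every statement below is [folklore] calculus,
kernel-proved.

## What this file is

Leaf (19) of the kernel port of FRONT-SC §3n (the oblique half of the tree's typed open node
`StrongCouplingQuarterCovariance.QuarterCovariance`).  The flux method (J-SC16d/e/f: `radialDiv`,
`integral_inner_eq_integral_radialDiv`, `radialDiv_smul`, `abs_integral_lipschitz_mul_inner_le`) bounds
`|∫ φ ⟪W x, x⟫ dσ|` for a smooth field `W : ℍ → ℍ` with `∫ ⟪W x, x⟫ dσ = 0` by the ball integrals of `|radialDiv W|`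
and `‖W‖`.  This file fixes the ONE explicit family of fields used for the covariance `Cov_{ν_B}(φ, 2 Re tr(· Δ))`,
    `W(y) = e^{κ y₀} · (e + (α y₀ + β) y)`     (`κ α β : ℝ`, `e : ℍ`, `y₀ = Re y`),
and proves, for every `y : ℍ`:
* smoothness (`contDiff_fluxField`), with `Re` handled as the continuous linear form `innerSL ℝ 1` (`re_eq_innerSL`);
* the TRACE `⟪W y, y⟫ = e^{κ y₀}(⟪e, y⟫ + (α y₀ + β)|y|²)` (`inner_fluxField`);
* the FRAME DIVERGENCE `radialDiv W (y) = |y|² e^{κ y₀}(4β + κ e₀ + (5α + κβ) y₀ + κα y₀²)` (`radialDiv_fluxField`;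
  from `radialDiv_affField`: `radialDiv (e + (α y₀ + β) y) = |y|²(5α y₀ + 4β)`, the product rule `radialDiv_smul`
  of J-SC16e and `d(e^{κ y₀})[h] = κ e^{κ y₀} h₀`);
* the SIZE `‖W y‖ = e^{κ y₀}‖e + (α y₀ + β) y‖`, `‖e + s y‖² = ‖e‖² + 2s⟪e, y⟫ + s²|y|²` and the pointwise AM–GM form
  `‖W y‖ ≤ (λ e^{κy₀} + e^{κy₀}‖…‖²/λ)/2` (`norm_fluxField`, `norm_add_smul_sq`, `norm_fluxField_le`);
* the REFLECTION SYMMETRY on `SU(2)`: if `Re e = 0` then `∫ ⟪e, x⟫ G(x₀) dσ = 0` for every `G : ℝ → ℝ`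
  (`integral_inner_mul_eq_zero`, from J-SC15's reflections `x ↦ −u x̄ u`, `integral_comp_reflect`), and hence the
  sphere mean of the trace, `∫ ⟪W x, x⟫ dσ = (e₀ + α) Z′ + β Z` with `Z = ∫ e^{κx₀} dσ`, `Z′ = ∫ x₀ e^{κx₀} dσ`,
  when `e = e⊥ + e₀`, `Re e⊥ = 0` (`integral_inner_fluxField`).
The next leaf (J-SC16k, `StrongCouplingFluxCovariance`) instantiates `e = d⊥ + pA`, `α = pε`, `β = −pZ′/Z`
(`A = 1 − κ²/20`, `ε = κ²/20`) and closes the covariance bound with the ball certificate (J-SC16h/i).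

NOT CLAIMED: `QuarterCovariance` itself or any number; no mass-gap claim.
-/

noncomputable section

open MeasureTheory Filter Finset Real
open scoped NNReal Quaternion Matrix ComplexConjugate BigOperators Matrix.Norms.Frobenius ContDiff Topology
  RealInnerProductSpace
open Matrix Complex
open Literature.MathematicalPhysics.QuantumLattice (su2Quat quatMatrix quatMatrix_mul quatMatrix_su2Quat norm_su2Quat)
open Literature.MathematicalPhysics.QuantumFieldTheory
open Literature.MathematicalPhysics.QuantumFieldTheory.SUNBakryEmery
open Literature.MathematicalPhysics.QuantumFieldTheory.Balaban1983to89.StrongCouplingVarianceWindow (qI qJ qK)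

namespace Summit.QuantumFields.BalabanUV.InfraRed.StrongCouplingFluxField

open Summit.QuantumFields.BalabanUV.InfraRed.StrongCouplingSphereCalculus
open Summit.QuantumFields.BalabanUV.InfraRed.StrongCouplingFluxBound (radialDiv_smul)
open Summit.QuantumFields.BalabanUV.InfraRed.StrongCouplingReflection (reflect su2Quat_reflect
  neg_mul_star_mul_eq integral_comp_reflect)

/-! ## 1. The coordinate `y₀ = Re y` as a continuous linear form -/

/-- `Re y = ⟪1, y⟫`: the real part is the continuous linear form `innerSL ℝ 1`. [folklore] -/
theorem re_eq_innerSL (y : ℍ) : y.re = innerSL ℝ (1 : ℍ) y := by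
  rw [innerSL_apply_apply, Quaternion.inner_def, one_mul, Quaternion.re_star]

/-- The real part is smooth. [folklore] -/
theorem contDiff_re : ContDiff ℝ ∞ fun y : ℍ => y.re := by
  have h : (fun y : ℍ => y.re) = fun y => innerSL ℝ (1 : ℍ) y := funext re_eq_innerSL
  rw [h]; exact (innerSL ℝ (1 : ℍ)).contDiff

/-- The real part has derivative `innerSL ℝ 1` everywhere. [folklore] -/
theorem hasFDerivAt_re (y : ℍ) : HasFDerivAt (fun y : ℍ => y.re) (innerSL ℝ (1 : ℍ)) y := by
  have h : (fun y : ℍ => y.re) = fun y => innerSL ℝ (1 : ℍ) y := funext re_eq_innerSL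
  rw [h]; exact (innerSL ℝ (1 : ℍ)).hasFDerivAt

/-! ## 2. The radial exponential weight `Φ(y) = e^{κ y₀}` -/

/-- `y ↦ e^{κ y₀}` is smooth. [folklore] -/
theorem contDiff_expRe (κ : ℝ) : ContDiff ℝ ∞ fun y : ℍ => Real.exp (κ * y.re) :=
  (contDiff_const.mul contDiff_re).exp

/-- `d(e^{κ y₀})(y)[h] = κ e^{κ y₀} h₀`. [folklore] -/
theorem fderiv_expRe (κ : ℝ) (y h : ℍ) :
    fderiv ℝ (fun y : ℍ => Real.exp (κ * y.re)) y h = κ * Real.exp (κ * y.re) * h.re := by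
  have h1 : HasFDerivAt (fun y : ℍ => κ * y.re) (κ • innerSL ℝ (1 : ℍ)) y := (hasFDerivAt_re y).const_mul κ
  rw [h1.exp.fderiv]
  simp only [FunLike.coe_smul, Pi.smul_apply, smul_eq_mul, ← re_eq_innerSL]
  ring

/-! ## 3. The affine-radial field `V(y) = e + (α y₀ + β) y` -/

/-- The derivative of `V(y) = e + (α y₀ + β)·y`: `dV(y)[h] = (α y₀ + β) h + (α h₀) y`. [folklore] -/
theorem hasFDerivAt_affField (e : ℍ) (α β : ℝ) (y : ℍ) :
    HasFDerivAt (fun y : ℍ => e + (α * y.re + β) • y)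
      ((α * y.re + β) • ContinuousLinearMap.id ℝ ℍ + (α • innerSL ℝ (1 : ℍ)).smulRight y) y := by
  have hs : HasFDerivAt (fun y : ℍ => α * y.re + β) (α • innerSL ℝ (1 : ℍ)) y :=
    ((hasFDerivAt_re y).const_mul α).add_const β
  have h := (hs.smul (hasFDerivAt_id y)).const_add e
  exact h

/-- `V` is smooth. [folklore] -/
theorem contDiff_affField (e : ℍ) (α β : ℝ) : ContDiff ℝ ∞ fun y : ℍ => e + (α * y.re + β) • y :=
  contDiff_const.add (((contDiff_const.mul contDiff_re).add contDiff_const).smul contDiff_id)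

/-- The value of `dV(y)` on a vector `h`. [folklore] -/
theorem fderiv_affField (e : ℍ) (α β : ℝ) (y h : ℍ) :
    fderiv ℝ (fun y : ℍ => e + (α * y.re + β) • y) y h = (α * y.re + β) • h + (α * h.re) • y := by
  rw [(hasFDerivAt_affField e α β y).fderiv]
  simp only [_root_.add_apply, FunLike.coe_smul, Pi.smul_apply, ContinuousLinearMap.id_apply,
    ContinuousLinearMap.smulRight_apply, smul_eq_mul, ← re_eq_innerSL]

/-- A quaternion whose squared components sum to `1` has norm `1`. [folklore] -/
private theorem norm_eq_one_of_sq {u : ℍ} (h : u.re ^ 2 + u.imI ^ 2 + u.imJ ^ 2 + u.imK ^ 2 = 1) : ‖u‖ = 1 := by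
  have h2 : ‖u‖ ^ 2 = 1 := by
    rw [sq, ← Quaternion.normSq_eq_norm_mul_self, Quaternion.normSq_def']; simpa [sq] using h
  have h0 : 0 ≤ ‖u‖ := norm_nonneg _
  nlinarith [h2, h0]

/-- The frame `{y, y·i, y·j, y·k}`: the transverse vectors are orthogonal to `y`; their real parts. [folklore] -/
theorem frame_inner (y : ℍ) :
    ⟪y * qI, y⟫ = 0 ∧ ⟪y * qJ, y⟫ = 0 ∧ ⟪y * qK, y⟫ = 0 ∧
    (y * qI).re = -y.imI ∧ (y * qJ).re = -y.imJ ∧ (y * qK).re = -y.imK := by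
  refine ⟨?_, ?_, ?_, ?_, ?_, ?_⟩ <;> simp [Quaternion.inner_def, qI, qJ, qK] <;> ring

/-- The frame vectors have the length of `y`. [folklore] -/
theorem frame_norm_sq (y : ℍ) :
    ⟪y * qI, y * qI⟫ = ‖y‖ ^ 2 ∧ ⟪y * qJ, y * qJ⟫ = ‖y‖ ^ 2 ∧ ⟪y * qK, y * qK⟫ = ‖y‖ ^ 2 ∧ ⟪y, y⟫ = ‖y‖ ^ 2 := by
  have hI : ‖qI‖ = 1 := norm_eq_one_of_sq (by simp [qI])
  have hJ : ‖qJ‖ = 1 := norm_eq_one_of_sq (by simp [qJ])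
  have hK : ‖qK‖ = 1 := norm_eq_one_of_sq (by simp [qK])
  refine ⟨?_, ?_, ?_, real_inner_self_eq_norm_sq y⟩ <;>
    rw [real_inner_self_eq_norm_sq, norm_mul] <;> simp [hI, hJ, hK]

/-- **The frame divergence of `V`**: `radialDiv V (y) = |y|² (5α y₀ + 4β)` (`div V = α y₀ + 4(α y₀ + β)`). [folklore] -/
theorem radialDiv_affField (e : ℍ) (α β : ℝ) (y : ℍ) :
    radialDiv (fun y : ℍ => e + (α * y.re + β) • y) y = ‖y‖ ^ 2 * (5 * α * y.re + 4 * β) := by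
  obtain ⟨h1, h2, h3, h8, h9, h10⟩ := frame_inner y
  obtain ⟨h4, h5, h6, h7⟩ := frame_norm_sq y
  have h1' : ⟪y, y * qI⟫ = 0 := by rw [real_inner_comm]; exact h1
  have h2' : ⟪y, y * qJ⟫ = 0 := by rw [real_inner_comm]; exact h2
  have h3' : ⟪y, y * qK⟫ = 0 := by rw [real_inner_comm]; exact h3
  simp only [radialDiv, fderiv_affField, inner_add_left, real_inner_smul_left, h1', h2', h3', h4, h5, h6, h7, h8, h9, h10]
  ring

/-! ## 4. The flux field `W(y) = e^{κ y₀} · (e + (α y₀ + β) y)` -/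

/-- `W` is smooth. [folklore] -/
theorem contDiff_fluxField (κ : ℝ) (e : ℍ) (α β : ℝ) :
    ContDiff ℝ ∞ fun y : ℍ => Real.exp (κ * y.re) • (e + (α * y.re + β) • y) :=
  (contDiff_expRe κ).smul (contDiff_affField e α β)

/-- **The trace of `W`**: `⟪W y, y⟫ = e^{κ y₀} (⟪e, y⟫ + (α y₀ + β) |y|²)`. [folklore] -/
theorem inner_fluxField (κ : ℝ) (e : ℍ) (α β : ℝ) (y : ℍ) :
    ⟪Real.exp (κ * y.re) • (e + (α * y.re + β) • y), y⟫ = Real.exp (κ * y.re) * (⟪e, y⟫ + (α * y.re + β) * ‖y‖ ^ 2) := by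
  rw [real_inner_smul_left, inner_add_left, real_inner_smul_left, real_inner_self_eq_norm_sq]

/-- **The frame divergence of `W`**:
`radialDiv W (y) = |y|² e^{κ y₀} (4β + κ e₀ + (5α + κβ) y₀ + κα y₀²)`. [folklore] -/
theorem radialDiv_fluxField (κ : ℝ) (e : ℍ) (α β : ℝ) (y : ℍ) :
    radialDiv (fun y : ℍ => Real.exp (κ * y.re) • (e + (α * y.re + β) • y)) y =
      ‖y‖ ^ 2 * Real.exp (κ * y.re) * (4 * β + κ * e.re + (5 * α + κ * β) * y.re + κ * α * y.re ^ 2) := by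
  have hΦ : Differentiable ℝ fun y : ℍ => Real.exp (κ * y.re) := (contDiff_expRe κ).differentiable (by simp)
  have hV : Differentiable ℝ fun y : ℍ => e + (α * y.re + β) • y := (contDiff_affField e α β).differentiable (by simp)
  rw [radialDiv_smul hΦ hV, radialDiv_affField, fderiv_expRe]
  simp only [Quaternion.re_add, Quaternion.re_smul, smul_eq_mul]
  ring

/-- **The size of `W`**: `‖W y‖ = e^{κ y₀} ‖e + (α y₀ + β) y‖`. [folklore] -/
theorem norm_fluxField (κ : ℝ) (e : ℍ) (α β : ℝ) (y : ℍ) :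
    ‖Real.exp (κ * y.re) • (e + (α * y.re + β) • y)‖ = Real.exp (κ * y.re) * ‖e + (α * y.re + β) • y‖ := by
  rw [norm_smul, Real.norm_eq_abs, abs_of_pos (Real.exp_pos _)]

/-- `‖e + s·y‖² = ‖e‖² + 2 s ⟪e, y⟫ + s² |y|²`. [folklore] -/
theorem norm_add_smul_sq (e y : ℍ) (s : ℝ) : ‖e + s • y‖ ^ 2 = ‖e‖ ^ 2 + 2 * s * ⟪e, y⟫ + s ^ 2 * ‖y‖ ^ 2 := by
  rw [norm_add_sq_real, norm_smul, real_inner_smul_right, mul_pow, Real.norm_eq_abs, sq_abs]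
  ring

/-- **Pointwise AM–GM for the size of `W`**: for every `λ > 0`,
`‖W y‖ ≤ (λ e^{κ y₀} + e^{κ y₀} ‖e + (α y₀ + β) y‖² / λ) / 2`. [folklore] -/
theorem norm_fluxField_le (κ : ℝ) (e : ℍ) (α β : ℝ) (y : ℍ) {l : ℝ} (hl : 0 < l) :
    ‖Real.exp (κ * y.re) • (e + (α * y.re + β) • y)‖ ≤
      (l * Real.exp (κ * y.re) + Real.exp (κ * y.re) * ‖e + (α * y.re + β) • y‖ ^ 2 / l) / 2 := by
  rw [norm_fluxField]
  have hE := Real.exp_pos (κ * y.re)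
  set E := Real.exp (κ * y.re)
  set n := ‖e + (α * y.re + β) • y‖
  have hn : 0 ≤ n := norm_nonneg _
  rw [le_div_iff₀ two_pos, ← sub_nonneg]
  have : l * E + E * n ^ 2 / l - E * n * 2 = E * (l - n) ^ 2 / l := by field_simp; ring
  rw [this]; positivity

/-! ## 5. Reflection symmetry: transverse linear forms integrate to zero against functions of `x₀` -/

/-- Continuity of `su2Quat`. [folklore] -/
private theorem continuous_su2QuatFF : Continuous (su2Quat : Matrix.specialUnitaryGroup (Fin 2) ℂ → ℍ) := by
  have h : Continuous fun g : Matrix.specialUnitaryGroup (Fin 2) ℂ => quatOfMat (g : Matrix (Fin 2) (Fin 2) ℂ) :=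
    (LinearMap.continuous_of_finiteDimensional quatOfMat).comp continuous_subtype_val
  simpa only [quatOfMat_coe] using h

/-- **Transverse symmetry.** If `Re e = 0` then `∫ ⟪e, x⟫ · G(x₀) dσ(x) = 0` for EVERY `G : ℝ → ℝ`: the reflection
`x ↦ −u x̄ u` (`u = e/‖e‖`) preserves Haar measure and `x₀` and negates `⟪e, x⟫`. [folklore] -/
theorem integral_inner_mul_eq_zero {e : ℍ} (he : e.re = 0) (G : ℝ → ℝ) :
    ∫ g : Matrix.specialUnitaryGroup (Fin 2) ℂ, ⟪e, su2Quat g⟫ * G (su2Quat g).re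
      ∂haarProbability (Matrix.specialUnitaryGroup (Fin 2) ℂ) = 0 := by
  by_cases h0 : e = 0
  · simp [h0]
  have hn : ‖e‖ ≠ 0 := norm_ne_zero_iff.2 h0
  have hnp : 0 < ‖e‖ := norm_pos_iff.2 h0
  set u : ℍ := ‖e‖⁻¹ • e with hu
  have hu1 : ‖u‖ = 1 := by rw [hu, norm_smul, norm_inv, norm_norm, inv_mul_cancel₀ hn]
  have hure : u.re = 0 := by rw [hu, Quaternion.re_smul, he, smul_zero]
  -- the reflected coordinate and pairing
  have hre : ∀ x : ℍ, (-u * star x * u).re = x.re := fun x => by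
    rw [neg_mul_star_mul_eq x hu1, Quaternion.re_sub, Quaternion.re_smul, hure, smul_zero, sub_zero]
  have hin : ∀ x : ℍ, ⟪e, -u * star x * u⟫ = -⟪e, x⟫ := fun x => by
    rw [neg_mul_star_mul_eq x hu1, inner_sub_right, real_inner_smul_right, ← Quaternion.inner_def, hu,
      real_inner_smul_right, real_inner_smul_right, real_inner_self_eq_norm_sq, real_inner_comm e x]
    field_simp
    ring
  have h := integral_comp_reflect u hu1 (fun g => ⟪e, su2Quat g⟫ * G (su2Quat g).re)
  simp only [su2Quat_reflect] at h
  simp only [hre, hin] at h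
  simp only [neg_mul, integral_neg] at h
  linarith

/-- **Mean of the trace of `W` on the sphere.** On `SU(2)` (`|x| = 1`), if `e = e⊥ + e₀` with `Re e⊥ = 0`:
`∫ ⟪W x, x⟫ dσ = (e₀ + α) ∫ x₀ e^{κx₀} dσ + β ∫ e^{κx₀} dσ`. [folklore] -/
theorem integral_inner_fluxField (κ : ℝ) {e' : ℍ} (he' : e'.re = 0) (e₀ α β : ℝ) :
    ∫ g : Matrix.specialUnitaryGroup (Fin 2) ℂ,
        ⟪Real.exp (κ * (su2Quat g).re) • ((e' + e₀) + (α * (su2Quat g).re + β) • su2Quat g), su2Quat g⟫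
      ∂haarProbability (Matrix.specialUnitaryGroup (Fin 2) ℂ) =
      (e₀ + α) * ∫ g : Matrix.specialUnitaryGroup (Fin 2) ℂ, (su2Quat g).re * Real.exp (κ * (su2Quat g).re)
          ∂haarProbability (Matrix.specialUnitaryGroup (Fin 2) ℂ) +
        β * ∫ g : Matrix.specialUnitaryGroup (Fin 2) ℂ, Real.exp (κ * (su2Quat g).re)
          ∂haarProbability (Matrix.specialUnitaryGroup (Fin 2) ℂ) := by
  have hq := continuous_su2QuatFF
  have hre : Continuous fun g : Matrix.specialUnitaryGroup (Fin 2) ℂ => (su2Quat g).re :=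
    Quaternion.continuous_re.comp hq
  have hE : Continuous fun g : Matrix.specialUnitaryGroup (Fin 2) ℂ => Real.exp (κ * (su2Quat g).re) :=
    (continuous_const.mul hre).rexp
  have h0 : ∀ g : Matrix.specialUnitaryGroup (Fin 2) ℂ, ⟪(e₀ : ℍ), su2Quat g⟫ = e₀ * (su2Quat g).re := fun g => by
    rw [Quaternion.inner_def, Quaternion.re_mul, Quaternion.re_star]
    simp
  have hpt : ∀ g : Matrix.specialUnitaryGroup (Fin 2) ℂ,
      ⟪Real.exp (κ * (su2Quat g).re) • ((e' + e₀) + (α * (su2Quat g).re + β) • su2Quat g), su2Quat g⟫ =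
        ⟪e', su2Quat g⟫ * Real.exp (κ * (su2Quat g).re) +
          ((e₀ + α) * ((su2Quat g).re * Real.exp (κ * (su2Quat g).re)) + β * Real.exp (κ * (su2Quat g).re)) := by
    intro g
    rw [inner_fluxField, norm_su2Quat, inner_add_left, h0]
    ring
  simp_rw [hpt]
  have i1 : Integrable (fun g : Matrix.specialUnitaryGroup (Fin 2) ℂ => ⟪e', su2Quat g⟫ * Real.exp (κ * (su2Quat g).re))
      (haarProbability (Matrix.specialUnitaryGroup (Fin 2) ℂ)) :=
    integrable_of_continuous_SUN ((continuous_const.inner hq).mul hE) _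
  have i2 : Integrable (fun g : Matrix.specialUnitaryGroup (Fin 2) ℂ =>
      (e₀ + α) * ((su2Quat g).re * Real.exp (κ * (su2Quat g).re))) (haarProbability (Matrix.specialUnitaryGroup (Fin 2) ℂ)) :=
    integrable_of_continuous_SUN (continuous_const.mul (hre.mul hE)) _
  have i3 : Integrable (fun g : Matrix.specialUnitaryGroup (Fin 2) ℂ => β * Real.exp (κ * (su2Quat g).re))
      (haarProbability (Matrix.specialUnitaryGroup (Fin 2) ℂ)) :=
    integrable_of_continuous_SUN (continuous_const.mul hE) _
  have i23 : Integrable (fun g : Matrix.specialUnitaryGroup (Fin 2) ℂ =>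
      (e₀ + α) * ((su2Quat g).re * Real.exp (κ * (su2Quat g).re)) + β * Real.exp (κ * (su2Quat g).re))
      (haarProbability (Matrix.specialUnitaryGroup (Fin 2) ℂ)) := i2.add i3
  rw [integral_add i1 i23, integral_add i2 i3, integral_const_mul, integral_const_mul,
    integral_inner_mul_eq_zero he' (fun t => Real.exp (κ * t)), zero_add]

end Summit.QuantumFields.BalabanUV.InfraRed.StrongCouplingFluxField
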